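import Summits.ABC.StewartYu.GenThreeEndBridgeReal
import Summits.ABC.StewartYu.GenThreeEndReal
import Summits.ABC.StewartYu.PadicG3TwoMainChainSat
import Mathlib.LinearAlgebra.Matrix.ToLinearEquiv
import HarnessLib

/-!
# Cell abc-stewartyu, WP-L.P(2) (crux r4 `PadicCoreTwoRat`, stmt-ABC-20504), END layer: the END ADAPTER of the
# 𝔑-THREADED `2`-adic frame in `ξ`-FORM — native identities on the generators `ϑ` ⇒ `FrameOutputReal` at `ξⱼ = αoⱼ^{1/N}`

`Summits/ABC/StewartYu/PadicG3TwoEndSat.lean` — cell `abc-stewartyu` (HOME `run/shared/lean/pub/abc-stewartyu/`), route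
`YuMatveevShapeRat`, seat p3 (g9, WP-L.P(2) lead; design memo HOME/p3/memo-11 §1 (M4), §2 row «output / END adapter», §4 (r1)).
Theorems only; no named fact.  Twin of p3-g5's `PadicG3TwoEndAdapter.frameOutputTwo_of_g3φ` for the saturated frame, on p2-g6's
shared output algebra `GenThreeEndBridgeReal` (`MomentGL` = `DirWeights.sum_mul_prod_pow_eq_zero_of_linear` and the Units bridge
`frameOutputReal_of_hasseIdentities`).

Setting: `S : TwoSetup` on the squared saturated basis `ϑ = all` (pivot last, coefficients `ball = b̃`), `F : S.SatData`
(`allᵢ^N = ∏ⱼ αoⱼ^{Uᵢⱼ}`), the crux's coefficient vector `b` with **`ball ᵥ* U = N·b`** (from `b̃ = b ᵥ* C`, `C·U = N·1`), and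
the units `ξⱼ = αoⱼ^{1/N}` (`GenThreeEndReal.rpowUnit`).  For a last-level family (`Rᵢ`, `κᵢ = (uᵢ, u_θᵢ)`, `pᵢ`) whose native
values `g3φ τ x` vanish for `|x| ≤ (d+2)X`, `|τ| ≤ (d+2)S₀`, with one nonzero `κ`-fibre and VIRTUAL box `|(κᵢ ᵥ* U)ⱼ| ≤ Dvⱼ`:

* `zmon_cast_eq_prod_rpowUnit_zpow` — `(zmon(κᵢ, x) : ℂ) = ∏ⱼ ξⱼ^{x·(κᵢ ᵥ* U)ⱼ}` (both are positive reals with the same `N`-th power,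
  `SatCoords.prod_zpow_pow_eq`);
* `linForm_eq_sum_dirScalar` — a linear form annihilating `ball` is `(b_θ)⁻¹·Σₖ f(eₖ)·𝔛ₖ` (the directional scalars
  `𝔛ₖ(κ) = b_θ κₖ − b̃ₖ κ_θ`); applied to `ℓₘ ∘ (ᵥ* U)`, `ℓₘ(ν) = b_{j₀}νₘ − bₘν_{j₀}` (which annihilates `ball` because `ball ᵥ* U = N·b`);
* **`frameOutputReal_of_g3φ_sat`** — `FrameOutputReal (d+1) ξ b j₀ D₀ S₀ X Dv` with `κ`-index `κᵢ ᵥ* U` (injective: `det U ≠ 0`).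

WHAT THIS IS NOT: no record, no exits (those are the landed `GenThreeEndReal.exists_exits_units` in `dichotomyTwoRat_of_frame`); no crux
moves (A1.L not moved).

References: Yu. V. Nesterenko, LNM 1819 (2003), §5.1 (5.3)–(5.4) (`P(Y) = Y^{−N𝐯}𝒢(Y₀, Y^N)`, `ξⱼ = αⱼ^{1/N}`), §4.3 (4.42);
K. Yu, Acta Math. 211 (2013), §6; HOME/p3/memo-11 §1–§2.
-/

noncomputable section

open Finset Polynomial
open scoped Matrix
open Literature.NumberTheory.Transcendental
open Literature.NumberTheory.Transcendental.CW77.Setup (Tau tauNorm)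

namespace Summit.ABC.StewartYu

namespace TwoSetup

variable (S : TwoSetup) (F : S.SatData) {ι : Type*} (R : ι → ℚ[X]) (u : ι → Fin S.d → ℤ) (uθ : ι → ℤ)

/-! ### The monomials at `ξ = αo^{1/N}` -/

/-- The real `N`-th roots of the original generators: `rⱼ = αoⱼ^{1/N} > 0`. [folklore] -/
theorem rpow_inv_pos (j : Fin (S.d + 1)) : 0 < (F.αo j : ℝ) ^ ((F.N : ℝ)⁻¹) :=
  Real.rpow_pos_of_pos (by exact_mod_cast F.hαo j) _

/-- **The monomial of an unknown at the real point**: `zmon(κᵢ, x) = ∏ⱼ (αoⱼ^{1/N})^{x·(κᵢ ᵥ* U)ⱼ}` in `ℝ` — both sides are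
positive and have the same `N`-th power `∏ⱼ αoⱼ^{x·(κᵢ ᵥ* U)ⱼ}` (`SatCoords.prod_zpow_pow_eq`).
[cite: Nesterenko2003, §5.1 (5.3)–(5.4); shape only] -/
theorem zmon_real_eq_prod_rpow_zpow (i : ι) (x : ℤ) :
    ((S.zmon (u i) (uθ i) x : ℚ) : ℝ) = ∏ j, ((F.αo j : ℝ) ^ ((F.N : ℝ)⁻¹)) ^ (x * (S.allκ u uθ i ᵥ* F.U) j) := by
  have hN0 : F.N ≠ 0 := F.hN.ne'
  have hall0 : ∀ k, S.toQ.all k ≠ 0 := fun k => (F.hall k).ne'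
  -- positivity of both sides
  have hzpos : 0 < ((S.zmon (u i) (uθ i) x : ℚ) : ℝ) := by
    rw [← S.prod_all_zpow_eq_zmon u uθ i x]
    push_cast
    exact Finset.prod_pos fun k _ => zpow_pos (by exact_mod_cast F.hall k) _
  have hrpos : 0 < ∏ j, ((F.αo j : ℝ) ^ ((F.N : ℝ)⁻¹)) ^ (x * (S.allκ u uθ i ᵥ* F.U) j) :=
    Finset.prod_pos fun j _ => zpow_pos (S.rpow_inv_pos F j) _
  -- the `N`-th powers agree
  have hμ : ((fun k => x * S.allκ u uθ i k) ᵥ* F.U) = fun j => x * (S.allκ u uθ i ᵥ* F.U) j := by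
    have : (fun k => x * S.allκ u uθ i k) = x • S.allκ u uθ i := by funext k; simp
    rw [this, Matrix.smul_vecMul]
    funext j; simp
  have hQ : (S.zmon (u i) (uθ i) x) ^ F.N = ∏ j, F.αo j ^ (x * (S.allκ u uθ i ᵥ* F.U) j) := by
    rw [← S.prod_all_zpow_eq_zmon u uθ i x,
      SatCoords.prod_zpow_pow_eq F.αo S.toQ.all F.U F.N F.αo_ne F.hU (fun k => x * S.allκ u uθ i k), hμ]
  have h1 : (((S.zmon (u i) (uθ i) x : ℚ) : ℝ)) ^ F.N = ∏ j, (F.αo j : ℝ) ^ (x * (S.allκ u uθ i ᵥ* F.U) j) := by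
    have := congrArg (fun q : ℚ => (q : ℝ)) hQ
    push_cast at this
    exact this
  have h2 : (∏ j, ((F.αo j : ℝ) ^ ((F.N : ℝ)⁻¹)) ^ (x * (S.allκ u uθ i ᵥ* F.U) j)) ^ F.N =
      ∏ j, (F.αo j : ℝ) ^ (x * (S.allκ u uθ i ᵥ* F.U) j) := by
    rw [← Finset.prod_pow]
    refine Finset.prod_congr rfl fun j _ => ?_
    rw [← zpow_natCast, ← zpow_mul, mul_comm, zpow_mul, zpow_natCast,
      Real.rpow_inv_natCast_pow (by exact_mod_cast (F.hαo j).le) hN0]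
  exact (pow_left_inj₀ hzpos.le hrpos.le hN0).mp (h1.trans h2.symm)

/-- The same in `ℂ` at the units `ξⱼ = rpowUnit αoⱼ (1/N)`: `(zmon(κᵢ, x) : ℂ) = ∏ⱼ ξⱼ^{x·(κᵢ ᵥ* U)ⱼ}`.
[cite: Nesterenko2003, §5.1 (5.3)–(5.4); shape only] -/
theorem zmon_cast_eq_prod_rpowUnit_zpow (i : ι) (x : ℤ) :
    (((S.zmon (u i) (uθ i) x : ℚ) : ℝ) : ℂ) =
      ∏ j, ((GenThreeEndReal.rpowUnit (F.αo j : ℝ) (by exact_mod_cast F.hαo j) ((F.N : ℝ)⁻¹) : ℂˣ) : ℂ) ^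
        (x * (S.allκ u uθ i ᵥ* F.U) j) := by
  rw [S.zmon_real_eq_prod_rpow_zpow F u uθ i x]
  push_cast
  refine Finset.prod_congr rfl fun j _ => ?_
  rw [GenThreeEndReal.val_rpowUnit]

/-! ### The linear forms annihilating `ball` through the directional scalars -/

/-- **A linear form annihilating `ball = (b̃, b_θ)` is a combination of the directional scalars**: if `Σₗ fₗ·ballₗ = 0` then
`Σₗ fₗ·κₗ = (b_θ)⁻¹·Σₖ f(castSucc k)·𝔛ₖ(κ)` for `κ = (v, v_θ)`, `𝔛ₖ = b_θ vₖ − b̃ₖ v_θ`. [folklore] -/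
theorem linForm_eq_sum_dirScalar (f : Fin (S.d + 1) → ℚ) (hf : ∑ l, f l * (S.ball l : ℚ) = 0)
    (v : Fin S.d → ℤ) (vθ : ℤ) :
    ∑ l, f l * ((Fin.snoc v vθ : Fin (S.d + 1) → ℤ) l : ℚ) =
      ((S.bθ : ℚ))⁻¹ * ∑ k : Fin S.d, f (Fin.castSucc k) * (S.dirScalar v vθ k : ℚ) := by
  have hbθ : (S.bθ : ℚ) ≠ 0 := by exact_mod_cast S.bθ_ne
  have hball : ∀ l, (S.ball l : ℚ) = ((Fin.snoc S.b S.bθ : Fin (S.d + 1) → ℤ) l : ℚ) := fun l => rfl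
  have e2 : ∑ l, f l * ((Fin.snoc v vθ : Fin (S.d + 1) → ℤ) l : ℚ) =
      ∑ k : Fin S.d, f (Fin.castSucc k) * (v k : ℚ) + f (Fin.last S.d) * (vθ : ℚ) := by
    rw [Fin.sum_univ_castSucc]; simp only [Fin.snoc_castSucc, Fin.snoc_last]
  have e3 : ∑ l, f l * (S.ball l : ℚ) =
      ∑ k : Fin S.d, f (Fin.castSucc k) * (S.b k : ℚ) + f (Fin.last S.d) * (S.bθ : ℚ) := by
    rw [Fin.sum_univ_castSucc]; simp only [hball, Fin.snoc_castSucc, Fin.snoc_last]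
  have h3 : ∑ k : Fin S.d, f (Fin.castSucc k) * (S.b k : ℚ) = -(f (Fin.last S.d) * (S.bθ : ℚ)) := by
    rw [hf] at e3; linear_combination -e3
  have hsum : ∑ k : Fin S.d, f (Fin.castSucc k) * (S.dirScalar v vθ k : ℚ) =
      (S.bθ : ℚ) * ∑ l, f l * ((Fin.snoc v vθ : Fin (S.d + 1) → ℤ) l : ℚ) := by
    have e1 : ∑ k : Fin S.d, f (Fin.castSucc k) * (S.dirScalar v vθ k : ℚ) =
        (S.bθ : ℚ) * ∑ k : Fin S.d, f (Fin.castSucc k) * (v k : ℚ) -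
          (vθ : ℚ) * ∑ k : Fin S.d, f (Fin.castSucc k) * (S.b k : ℚ) := by
      unfold dirScalar
      push_cast
      simp only [Finset.mul_sum, ← Finset.sum_sub_distrib]
      refine Finset.sum_congr rfl fun k _ => ?_
      ring
    rw [e1, h3, e2]
    ring
  rw [hsum, ← mul_assoc, inv_mul_cancel₀ hbθ, one_mul]

/-! ### The END adapter -/

/-- `v ↦ v ᵥ* U` is injective on integer vectors when `det U ≠ 0`. [folklore] -/
theorem vecMul_injective_of_det_ne_zero {n : ℕ} (U : Matrix (Fin n) (Fin n) ℤ) (hU : U.det ≠ 0) :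
    Function.Injective fun v : Fin n → ℤ => v ᵥ* U := by
  classical
  intro v w h
  have h0 : (v - w) ᵥ* U = 0 := by
    rw [Matrix.sub_vecMul]; exact sub_eq_zero.mpr h
  by_contra hne
  exact hU (Matrix.exists_vecMul_eq_zero_iff.mp ⟨v - w, sub_ne_zero.mpr hne, h0⟩)

/-- **THE END ADAPTER OF THE 𝔑-THREADED `2`-ADIC FRAME.**  Native identities `g3φ τ x = 0` (`|x| ≤ (d+2)X`, `|τ| ≤ (d+2)S₀`) of
a family with `Y₀`-degrees `≤ D₀`, VIRTUAL box `|(κᵢ ᵥ* U)ⱼ| ≤ Dvⱼ` and one nonzero `κ`-fibre, for the crux's `b` with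
`ball ᵥ* U = N·b` and `det U ≠ 0`, give `FrameOutputReal (d+1) ξ b j₀ D₀ S₀ X Dv` at `ξⱼ = rpowUnit αoⱼ (1/N)`, for ANY `j₀`.
[cite: Nesterenko2003, §5.1 (5.1)–(5.4)] [cite: Yu2013, §6; shape only] -/
theorem frameOutputReal_of_g3φ_sat (B : Finset ι) (p : ι → ℤ) {D₀ S₀ X : ℕ} {Dv : Fin (S.d + 1) → ℕ}
    (b : Fin (S.d + 1) → ℤ) (hbU : S.ball ᵥ* F.U = (F.N : ℤ) • b) (hdetU : F.U.det ≠ 0) (j₀ : Fin (S.d + 1))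
    (hR : ∀ i ∈ B, (R i).natDegree ≤ D₀)
    (hκ : ∀ i ∈ B, ∀ j, |(S.allκ u uθ i ᵥ* F.U) j| ≤ (Dv j : ℤ))
    (hne : ∃ κ₀ : Fin (S.d + 1) → ℤ,
      ∑ i ∈ B.filter (fun i => S.allκ u uθ i = κ₀), (p i : ℚ) • R i ≠ 0)
    (hzero : ∀ x : ℤ, |x| ≤ (((S.d + 1 + 1) * X : ℕ) : ℤ) → ∀ τ : Tau S.d,
      tauNorm τ ≤ (S.d + 1 + 1) * S₀ → S.g3φ R u uθ B p τ x = 0) :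
    GenThreeFrameSpecTwoRat.FrameOutputReal (S.d + 1)
      (fun j => GenThreeEndReal.rpowUnit (F.αo j : ℝ) (by exact_mod_cast F.hαo j) ((F.N : ℝ)⁻¹))
      b j₀ D₀ S₀ X Dv := by
  classical
  set κ' : ι → Fin (S.d + 1) → ℤ := fun i => S.allκ u uθ i ᵥ* F.U with hκ'
  have hinj := vecMul_injective_of_det_ne_zero F.U hdetU
  refine GenThreeEndBridgeReal.frameOutputReal_of_hasseIdentities B R κ' (fun i => (p i : ℚ)) _ b j₀ D₀ S₀ X Dv
    hR (fun i hi j => hκ i hi j) ?_ ?_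
  · -- the nonzero fibre, transported along the injective `ᵥ* U`
    obtain ⟨κ₀, hκ₀⟩ := hne
    refine ⟨κ₀ ᵥ* F.U, ?_⟩
    have hfil : B.filter (fun i => κ' i = κ₀ ᵥ* F.U) = B.filter (fun i => S.allκ u uθ i = κ₀) := by
      refine Finset.filter_congr fun i _ => ?_
      exact ⟨fun h => hinj h, fun h => by rw [hκ']; simp only [h]⟩
    rw [hfil]
    exact hκ₀
  · -- the identities
    intro x hx t ν hν hT
    -- (i) the monomials at `ξ`
    have hmon : ∀ i, ∏ j, ((GenThreeEndReal.rpowUnit (F.αo j : ℝ) (by exact_mod_cast F.hαo j)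
        ((F.N : ℝ)⁻¹) : ℂˣ) : ℂ) ^ (x * κ' i j) = (((S.zmon (u i) (uθ i) x : ℚ) : ℝ) : ℂ) :=
      fun i => (S.zmon_cast_eq_prod_rpowUnit_zpow F u uθ i x).symm
    simp_rw [hmon]
    -- (ii) reduce to a rational identity
    have hrat : ∑ i ∈ B, (p i : ℚ) * (hasseDeriv t (R i)).eval (x : ℚ) *
        (∏ k, ((b j₀ * κ' i k - b k * κ' i j₀ : ℤ) : ℚ) ^ ν k) * S.zmon (u i) (uθ i) x = 0 := by
      -- `MomentGL`: the `ℓ`-moments from the `𝔛`-moments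
      have hbθ : (S.bθ : ℚ) ≠ 0 := by exact_mod_cast S.bθ_ne
      -- the forms `ℓₘ ∘ (ᵥ* U)` annihilate `ball`
      set f : Fin (S.d + 1) → Fin (S.d + 1) → ℚ := fun m l =>
        ((b j₀ * F.U l m - b m * F.U l j₀ : ℤ) : ℚ) with hf
      have hfball : ∀ m, ∑ l, f m l * (S.ball l : ℚ) = 0 := by
        intro m
        have hNb : ∀ m', ∑ l, S.ball l * F.U l m' = (F.N : ℤ) * b m' := by
          intro m'
          have := congrFun hbU m'
          simp only [Matrix.vecMul, dotProduct, Pi.smul_apply, smul_eq_mul] at this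
          exact this
        have key : ∑ l, (b j₀ * F.U l m - b m * F.U l j₀) * S.ball l = 0 := by
          have e1 := hNb m
          have e2 := hNb j₀
          calc ∑ l, (b j₀ * F.U l m - b m * F.U l j₀) * S.ball l
              = b j₀ * ∑ l, S.ball l * F.U l m - b m * ∑ l, S.ball l * F.U l j₀ := by
                rw [Finset.mul_sum, Finset.mul_sum, ← Finset.sum_sub_distrib]
                refine Finset.sum_congr rfl fun l _ => ?_; ring
            _ = 0 := by rw [e1, e2]; ring
        simp only [hf]
        exact_mod_cast key
      -- `ℓₘ(κ'ᵢ) = Σₗ fₘₗ κᵢₗ = b_θ⁻¹ Σₖ fₘ(cs k) 𝔛ₖ(κᵢ)`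
      have hY : ∀ i ∈ B, ∀ m, ((b j₀ * κ' i m - b m * κ' i j₀ : ℤ) : ℚ) =
          ∑ k : Fin S.d, (((S.bθ : ℚ))⁻¹ * f m (Fin.castSucc k)) * (S.dirScalar (u i) (uθ i) k : ℚ) := by
        intro i _ m
        have e1 : ((b j₀ * κ' i m - b m * κ' i j₀ : ℤ) : ℚ) =
            ∑ l, f m l * ((Fin.snoc (u i) (uθ i) : Fin (S.d + 1) → ℤ) l : ℚ) := by
          simp only [hκ', hf, allκ, Matrix.vecMul, dotProduct]
          push_cast
          rw [Finset.mul_sum, Finset.mul_sum, ← Finset.sum_sub_distrib]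
          refine Finset.sum_congr rfl fun l _ => ?_; ring
        rw [e1, S.linForm_eq_sum_dirScalar (f m) (hfball m) (u i) (uθ i), Finset.mul_sum]
        refine Finset.sum_congr rfl fun k _ => ?_; ring
      -- the `𝔛`-moments vanish (native identities times `b_θ^{|T|}`)
      have hX : ∀ T : Fin S.d → ℕ, ∑ k, T k ≤ (S.d + 1 + 1) * S₀ - t →
          ∑ i ∈ B, ((p i : ℚ) * (hasseDeriv t (R i)).eval (x : ℚ) * S.zmon (u i) (uθ i) x) *
            ∏ k, (S.dirScalar (u i) (uθ i) k : ℚ) ^ T k = 0 := by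
        intro T hT'
        have hτ : tauNorm ((t, T) : Tau S.d) ≤ (S.d + 1 + 1) * S₀ := by
          unfold tauNorm; simp only; omega
        have h0 := hzero x hx (t, T) hτ
        have h1 : (S.bθ : ℚ) ^ (∑ j, T j) * S.g3φ R u uθ B p (t, T) x = 0 := by rw [h0, mul_zero]
        unfold g3φ at h1
        rw [Finset.mul_sum] at h1
        rw [← h1]
        refine Finset.sum_congr rfl fun i _ => ?_
        rw [← S.bθ_pow_mul_zγpow u uθ i T]
        simp only
        ring
      have hGL := DirWeights.sum_mul_prod_pow_eq_zero_of_linear B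
        (fun i => (p i : ℚ) * (hasseDeriv t (R i)).eval (x : ℚ) * S.zmon (u i) (uθ i) x)
        (fun i k => (S.dirScalar (u i) (uθ i) k : ℚ))
        (fun i m => ((b j₀ * κ' i m - b m * κ' i j₀ : ℤ) : ℚ))
        (fun m k => ((S.bθ : ℚ))⁻¹ * f m (Fin.castSucc k)) hY ((S.d + 1 + 1) * S₀ - t) hX ν (by omega)
      rw [← hGL]
      refine Finset.sum_congr rfl fun i _ => ?_
      ring
    have := congrArg (fun q : ℚ => ((q : ℝ) : ℂ)) hrat
    push_cast at this ⊢
    rw [← this]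

end TwoSetup

end Summit.ABC.StewartYu

end
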